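import Literature.Computability.Cryptography.RegevGIVPMachine
import Literature.Computability.Cryptography.RegevMainTheoremStages
import HarnessLib

/-!
# Regev 2009, Theorem 1.1 (SIVP half): what pqc.S19 rests on after Lemma 3.17 is a theorem

Topic `Computability/Cryptography` (family `pqc`). Bookkeeping corollary joining the two seats'
lines on the named fact `regev_lwe_to_sivp_quantum` (pqc.S19): with the average-case bridge `h₁`
proved (`LWEAmplification.lean`), Theorem 3.1 reduced to the loop principle `hLoop` and the stage
family `hStage` (`RegevMainTheoremStages.lean`, `Regev2009.thm_3_1_machine_of_stages`), and
Lemma 3.17 proved at machine level (`RegevGIVPMachine.lean`,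
`Regev2009.GIVPMachine.regev_dgs_to_givp_quantum`), pqc.S19 follows from `hLoop` and `hStage`
alone: **`regev_lwe_to_sivp_quantum_of_stages`**.

## References

* O. Regev, *On lattices, learning with errors, random linear codes, and cryptography*, J. ACM 56
  (2009), art. 34, Thm. 1.1, Thm. 3.1 (proof), Lemma 3.17 [Regev2009].
-/

noncomputable section

namespace Literature.Computability.Cryptography

open Filter Literature.Computability.Complexity Literature.Computability.Cryptography.LWE
  Literature.Algebra.EuclideanLattices Literature.Computability.QuantumComplexity

variable (q : ℕ → ℕ) [∀ n, NeZero (q n)] (α : ℕ → ℝ) (m : ℕ → ℕ)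

/-- **pqc.S19 (SIVP form) from the loop principle and the stage family of Theorem 3.1 only**:
`regev_lwe_to_sivp_quantum_of_stages_of_lemma317` with `h₃ := regev_dgs_to_givp_quantum`
(Lemma 3.17, proved). [cite: Regev2009, Thm. 1.1 from Thm. 3.1 (proof) and Lemma 3.17] -/
theorem regev_lwe_to_sivp_quantum_of_stages
    (hLoop : ∀ (S : UniformQCircuitFamily) (T m : Polynomial ℕ), ∃ D : UniformQCircuitFamily,
      ∀ (x : List Bool) (E : Set (List Bool)),
        (chainLaw 0 S.family (m.eval x.length) x (T.eval x.length)).toOuterMeasure E ≤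
          (D.kernel x).toOuterMeasure {z | ∃ y ∈ E, y <+: z})
    (hStage : ∀ (m : ℕ → ℕ) (_ : IsPolyBounded m) (_ : IsPolyTimeParams q α m)
      (_ : ∀ᶠ n : ℕ in atTop, 0 < α n ∧ α n < 1 ∧ 2 * Real.sqrt n < α n * q n)
      (_ : ∃ (W : UniformQCircuitFamily) (c : ℝ), 0 < c ∧
        W.SolvesSearchLWEWorstCase q (fun n => discretizedGaussian (q n) (α n)) m
          fun n => (2 : ℝ) ^ (-(c * n)))
      (ε : ℕ → ℝ), IsNegligible ε → (∀ n, 0 < ε n) →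
      ∃ (S : UniformQCircuitFamily) (N : ℕ → ℕ) (mS : Polynomial ℕ)
        (encB : (n : ℕ) → (Fin (N n) → Fin n → ℤ) → List Bool) (νS : ℕ → ℝ) (θ : ℕ → ℝ),
        IsNegligible νS ∧ (∀ n, 0 < n → α n * q n / Real.sqrt n ≤ θ n) ∧
        (∀ n (b b' : Fin (N n) → Fin n → ℤ) (z : List Bool), encB n b <+: z → encB n b' <+: z → b = b') ∧
        (∀ n (b : Fin (N n) → Fin n → ℤ) (w : List Bool) (j : Fin (N n)), (j : ℕ) = 0 →
          decodeLatticeVector n (encB n b ++ w) = b j) ∧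
        (∀ n, 0 < N n) ∧
        ∀ᶠ n : ℕ in atTop, ∀ (I : LatticeInstance) (r : ℚ) (x : List Bool), I.n = n → I.IsNonsingular →
          x = GapSVPInstance.encode (I, r) →
          ((2 : ℝ) ^ (2 * I.n) * successiveMinimum I.lattice I.n < Regev2009.levelRadius (θ I.n) (3 * I.n) r 0 →
            ((chainLaw 0 S.family (mS.eval x.length) x 1).map (Regev2009.readBatchE (encB I.n))).tvDist
              (Regev2009.idealBatch I (N I.n) (Regev2009.levelRadius (θ I.n) (3 * I.n) r 0)) ≤ νS I.n) ∧
          (∀ k, k < 3 * x.length →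
            (k < 3 * I.n → Real.sqrt 2 * q I.n * smoothingParameter I.lattice (ε I.n) <
              Regev2009.levelRadius (θ I.n) (3 * I.n) r k) →
            ((chainLaw 0 S.family (mS.eval x.length) x (k + 2)).map (Regev2009.readBatchE (encB I.n))).tvDist
                (Regev2009.idealBatch I (N I.n) (Regev2009.levelRadius (θ I.n) (3 * I.n) r (k + 1))) ≤
              ((chainLaw 0 S.family (mS.eval x.length) x (k + 1)).map (Regev2009.readBatchE (encB I.n))).tvDist
                  (Regev2009.idealBatch I (N I.n) (Regev2009.levelRadius (θ I.n) (3 * I.n) r k)) +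
                if k < 3 * I.n then νS I.n else 0)) :
    regev_lwe_to_sivp_quantum q α m :=
  regev_lwe_to_sivp_quantum_of_stages_of_lemma317 q α m hLoop hStage
    Regev2009.GIVPMachine.regev_dgs_to_givp_quantum

end Literature.Computability.Cryptography

end
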